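import Summits.QuantumFields.YangMills.Theorems.UnitScaleTiltProp7FirstVariationFibreCurve
import Summits.QuantumFields.YangMills.Theorems.UnitScaleTiltProp7Growth142T3ChartELStat
import HarnessLib

/-!
# Route `UnitScaleTilt`, crux K1 «MinimiserStabilityRegPr» (stmt-QuantumFields-19200) — THE FIBRE-CURVE EULER–LAGRANGE PACKAGE AT AN E–L-CRITICAL POINT
# (stationarity form of ★w1-19200's ✓`Prop7FirstVariationFibreCurve.exists_fibre_curve_lin_eq_zero_of_isCritR2`)

Cell `ym3-torus`, width seat `ym-ust-19200-w4` (gen 4).  THEOREMS ONLY (0 `def`, 0 `sorry`).  YM₃ on T³ is a ladder rung (R3), not the Clay problem; nothing here claims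
the stub, the crux, d = 4 or the mass gap.

WHY.  The EX knit of record (✓`Prop7StubEXOfChartPiecesTwS4`, `hcoW`) displays the background `W` through the E–L CLAUSE over `𝔅_k(V)` (stationarity of the Wilson action
along every bondwise-differentiable curve IN the fibre), not through R2-criticality; the `Q`-currency first-variation bound ✓`Prop7FirstVariationExactPairing.abs_lin_le_sum_norm_trueLinIter`
and its engine ✓`Prop7FirstVariationMultiplier.abs_lin_le_constraint_velocity` enter R2-criticality at exactly one point — ★w1's fibre-curve lemma, whose last conjunct
`Lin_{U₀}(ξ) = 0` comes from `IsMinOn`.  This file proves the same lemma from the E–L clause: p2's corrected lift `γ` of the ambient family lies in the fibre for `t`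
near `0`; its cut-off copy `φ` (`:= γ` on the good set, `:= U₀` elsewhere) lies in the fibre for ALL `t`, agrees with `γ` near `0`, so it has the same bond velocities `ξ`,
and the clause gives `(A∘φ)′(0) = 0 = Lin_{U₀}(ξ)` by ✓`Prop7Growth142T3ChartELStat.hasDerivAt_wilsonAction4_of_hasDerivAt_mulStar`.

WHAT IS PROVED (ns `…Theorems.Prop7FirstVariationFibreCurveStat`).  `exists_cutoff_curve` · ★★ `exists_fibre_curve_lin_eq_zero_of_fibreEL` — ★w1's statement VERBATIM with
`(hcrit : IsCritR2 F n K hnK V U₀)` replaced by `U₀ ∈ 𝔅_k(V)` and the E–L clause at `U₀` (same tower `T`, same ambient `Γ₀`, same seven conclusions incl. `Lin_{U₀}(ξ) = 0`).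

HONEST SCOPE.  Bookkeeping on top of p2's lift; `--supports stmt-QuantumFields-19200`, count-neutral.

References: T. Bałaban, CMP 102 (1985) 277–309 [Balaban1985Variational] ((2), (6) p.278, (127) p.297, (141)–(143) p.299); CMP 109 (1987) [Balaban1987RG1] ((0.11) p.253).
-/

noncomputable section

open scoped BigOperators Matrix.Norms.L2Operator Matrix Topology
open Filter NormedSpace

namespace Summit.QuantumFields.YangMills.Theorems.Prop7FirstVariationFibreCurveStat

open Literature.MathematicalPhysics.QuantumFieldTheory.Balaban1983to89
open T4Continuum AveragingRT BlockAveraging BlockAveragingHaarAC BlockAveragingEMLHaarAC ExpMeanLog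
open T3ContinuumYM3Torus T3UnitLawDensityEML T3ConstrainedMinimiser T3TiltDescent T3DescentFibreTower T3LevelShift
open T3PrintedRegularMinimiser T3Thm1CarrierNative
open Summit.QuantumFields.YangMills.Theorems.BlockAvgCorrector (stokesConst)
open Summit.QuantumFields.YangMills.Theorems.Prop8Criticality (exists_iter_lift_curve)
open Summit.QuantumFields.YangMills.Theorems.Prop8CriticalityAllL (t0_data_of_regPr_allL)
open Summit.QuantumFields.YangMills.Theorems.Prop7Growth142T3ChartELStat (hasDerivAt_wilsonAction4_of_hasDerivAt_mulStar)

section Cutoff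

/-- Cut-off: a curve through `W ∈ S` that lies in `S` for `t` near `0` agrees near `0` with a curve lying in `S` for ALL `t` (redefine it as `W` off the good set). [folklore] -/
theorem exists_cutoff_curve {X : Type*} {S : Set X} (γ : ℝ → X) {W : X} (hγ0 : γ 0 = W) (hW : W ∈ S) (hγS : ∀ᶠ t in 𝓝 (0 : ℝ), γ t ∈ S) :
    ∃ φ : ℝ → X, φ 0 = W ∧ (∀ t, φ t ∈ S) ∧ φ =ᶠ[𝓝 (0 : ℝ)] γ := by
  classical
  refine ⟨fun t => if γ t ∈ S then γ t else W, ?_, fun t => ?_, ?_⟩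
  · simp only [hγ0, hW, if_true]
  · by_cases h : γ t ∈ S
    · simp only [h, if_true]
    · simp only [h, if_false, hW]
  · filter_upwards [hγS] with t ht
    simp only [ht, if_true]

end Cutoff

variable (F : T3Family) {n K : ℕ}

/-- ★★ **FIBRE CURVES WITH VANISHING FIRST VARIATION AT AN E–L-CRITICAL POINT** — ★w1's ✓`exists_fibre_curve_lin_eq_zero_of_isCritR2` with R2-criticality replaced by the E–L
clause over `𝔅_k(V)`: for `U₀ ∈ 𝔘_k(ε₀) ∩ 𝔅_k(V)` (`10¹⁰L⁶ε₀ ≤ 1`), a downward-closed tower `T` exhausting the top level, and any bondwise-differentiable ambient family `Γ₀`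
through `U₀`, there are a curve `γ` (p2's corrected lift) and velocities `ξ` with `γ(0) = U₀`, `γ` bondwise differentiable, `γ(t) ∈ 𝔅_k(V)` near `0`, `γ = Γ₀` off `T₀` near `0`,
and `Lin_{U₀}(ξ) = 0`. [cite: Balaban1985Variational, (127) p.297, (141)-(143) p.299, (2), (6) p.278; Balaban1987RG1, (0.11) p.253] -/
theorem exists_fibre_curve_lin_eq_zero_of_fibreEL (hnK : n ≤ K)
    {V : GaugeField (F.P n) 0 (Matrix.specialUnitaryGroup (Fin 2) ℂ)} {U₀ : GaugeField (F.P K) 0 (Matrix.specialUnitaryGroup (Fin 2) ℂ)}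
    (hU₀fib : U₀ ∈ fibre F ℰp n K hnK V)
    (hEL : ∀ φ : ℝ → GaugeField (F.P K) 0 (Matrix.specialUnitaryGroup (Fin 2) ℂ), φ 0 = U₀ → (∀ t, φ t ∈ fibre F ℰp n K hnK V) →
      (∀ b : PBond (F.P K) 0, DifferentiableAt ℝ (fun t => ((φ t b : Matrix.specialUnitaryGroup (Fin 2) ℂ) : Matrix (Fin 2) (Fin 2) ℂ)) 0) →
        deriv (fun t => wilsonAction4 (φ t)) 0 = 0) {ε₀ : ℝ} (hε₀ : 0 < ε₀) (hε : 10 ^ 10 * (F.L : ℝ) ^ 6 * ε₀ ≤ 1) (hU₀reg : RegPr F n K ε₀ U₀)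
    (T : (i : ℕ) → Set (PBond (F.P K) i)) (hT : ∀ i, i < K - n → ∀ c : PBond (F.P K) (i + 1), c ∈ T (i + 1) → centralBond c ∈ T i)
    (hTk : ∀ c : PBond (F.P K) (K - n), c ∈ T (K - n))
    (Γ₀ : ℝ → GaugeField (F.P K) 0 (Matrix.specialUnitaryGroup (Fin 2) ℂ)) (hΓ₀0 : Γ₀ 0 = U₀)
    (hΓ₀diff : ∀ b : PBond (F.P K) 0, DifferentiableAt ℝ (fun t : ℝ => (Γ₀ t b : Matrix (Fin 2) (Fin 2) ℂ)) 0) :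
    ∃ (γ : ℝ → GaugeField (F.P K) 0 (Matrix.specialUnitaryGroup (Fin 2) ℂ)) (ξ : PBond (F.P K) 0 → Matrix (Fin 2) (Fin 2) ℂ),
      γ 0 = U₀ ∧
      (∀ b : PBond (F.P K) 0, DifferentiableAt ℝ (fun t : ℝ => (γ t b : Matrix (Fin 2) (Fin 2) ℂ)) 0) ∧
      (∀ᶠ t in 𝓝 (0 : ℝ), γ t ∈ fibre F ℰp n K hnK V) ∧
      (∀ b : PBond (F.P K) 0,
        HasDerivAt (fun t : ℝ => (γ t b : Matrix (Fin 2) (Fin 2) ℂ) * star (U₀ b : Matrix (Fin 2) (Fin 2) ℂ)) (ξ b) 0) ∧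
      (∀ b : PBond (F.P K) 0, b ∉ T 0 → ∀ᶠ t in 𝓝 (0 : ℝ), γ t b = Γ₀ t b) ∧
      ∑ p : Plaq (F.P K) 0, (1 / 2) * ((((((GaugeField.plaqHol U₀ p : Matrix.specialUnitaryGroup (Fin 2) ℂ) : Matrix (Fin 2) (Fin 2) ℂ)) - 1)ᴴ
          * ((ξ ⟨p.src, p.μ⟩
              + (U₀ ⟨p.src, p.μ⟩ : Matrix (Fin 2) (Fin 2) ℂ) * ξ ⟨p.src.shift p.μ, p.ν⟩ * star (U₀ ⟨p.src, p.μ⟩ : Matrix (Fin 2) (Fin 2) ℂ)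
              - ((U₀ ⟨p.src, p.μ⟩ * U₀ ⟨p.src.shift p.μ, p.ν⟩ * (U₀ ⟨p.src.shift p.ν, p.μ⟩)⁻¹ : Matrix.specialUnitaryGroup (Fin 2) ℂ) : Matrix (Fin 2) (Fin 2) ℂ)
                  * ξ ⟨p.src.shift p.ν, p.μ⟩
                  * star ((U₀ ⟨p.src, p.μ⟩ * U₀ ⟨p.src.shift p.μ, p.ν⟩ * (U₀ ⟨p.src.shift p.ν, p.μ⟩)⁻¹ : Matrix.specialUnitaryGroup (Fin 2) ℂ) : Matrix (Fin 2) (Fin 2) ℂ)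
              - ((GaugeField.plaqHol U₀ p : Matrix.specialUnitaryGroup (Fin 2) ℂ) : Matrix (Fin 2) (Fin 2) ℂ) * ξ ⟨p.src, p.ν⟩
                  * star ((GaugeField.plaqHol U₀ p : Matrix.specialUnitaryGroup (Fin 2) ℂ) : Matrix (Fin 2) (Fin 2) ℂ))
            * ((GaugeField.plaqHol U₀ p : Matrix.specialUnitaryGroup (Fin 2) ℂ) : Matrix (Fin 2) (Fin 2) ℂ))).trace).re = 0 := by
  classical
  obtain ⟨ht₀, hsmall, hU₀it⟩ := t0_data_of_regPr_allL F hε₀ hε hU₀reg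
  have hk : K - n ≤ (F.P K).m + (F.P K).K := by
    show K - n ≤ F.m + K; omega
  have hsm : ∀ i, i < K - n → PlaqSmall ((10800 * (F.L : ℝ) + 1) * ε₀)
      (Averaging.iter (fun i => blockAvg (P := F.P K) (j := i) (expMeanLogSU (n := Fin 2))) i (Γ₀ 0)) := by
    rw [hΓ₀0]; exact hU₀it
  obtain ⟨γ, hγ0, hγdiff, hγev, hγT⟩ := exists_iter_lift_curve (P := F.P K) ht₀ hsmall (K - n) hk Γ₀ hΓ₀diff hsm T hT
    (fun _ => Averaging.iter (fun i => blockAvg (P := F.P K) (j := i) (expMeanLogSU (n := Fin 2))) (K - n) U₀)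
    (fun _ => differentiableAt_const _) (by rw [hΓ₀0]) (fun c hc => absurd (hTk c) hc)
  have hγ0' : γ 0 = U₀ := hγ0.trans hΓ₀0
  -- the lifted family stays in the fibre, hence (near `0`) in print's regular fibre (6)(e)
  have hγfib : ∀ᶠ t in 𝓝 (0 : ℝ), γ t ∈ fibre F ℰp n K hnK V := by
    filter_upwards [hγev] with t ht
    rw [mem_fibre_iff] at hU₀fib ⊢
    rw [← hU₀fib]
    exact congrArg (fun W => fieldShift _ W) ht
  set ξ : PBond (F.P K) 0 → Matrix (Fin 2) (Fin 2) ℂ := fun b =>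
    deriv (fun t : ℝ => ((γ t b : Matrix.specialUnitaryGroup (Fin 2) ℂ) : Matrix (Fin 2) (Fin 2) ℂ) * star (U₀ b : Matrix (Fin 2) (Fin 2) ℂ)) 0 with hξ
  have hξd : ∀ b, HasDerivAt (fun t : ℝ => ((γ t b : Matrix.specialUnitaryGroup (Fin 2) ℂ) : Matrix (Fin 2) (Fin 2) ℂ) * star (U₀ b : Matrix (Fin 2) (Fin 2) ℂ))
      (ξ b) 0 :=
    fun b => ((hγdiff b).mul_const _).hasDerivAt
  -- the Euler–Lagrange clause along the cut-off copy of `γ` that stays in the fibre for all `t`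
  obtain ⟨φ, hφ0, hφfib, hφeq⟩ := exists_cutoff_curve γ hγ0' hU₀fib hγfib
  have hφdiff : ∀ b : PBond (F.P K) 0, DifferentiableAt ℝ (fun t : ℝ => ((φ t b : Matrix.specialUnitaryGroup (Fin 2) ℂ) : Matrix (Fin 2) (Fin 2) ℂ)) 0 := fun b =>
    (hγdiff b).congr_of_eventuallyEq (hφeq.mono fun t ht => by simp only [ht])
  have hφξ : ∀ b : PBond (F.P K) 0, HasDerivAt (fun t : ℝ => ((φ t b : Matrix.specialUnitaryGroup (Fin 2) ℂ) : Matrix (Fin 2) (Fin 2) ℂ) * star (U₀ b : Matrix (Fin 2) (Fin 2) ℂ)) (ξ b) 0 := fun b =>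
    (hξd b).congr_of_eventuallyEq (hφeq.mono fun t ht => by simp only [ht])
  have hD := hasDerivAt_wilsonAction4_of_hasDerivAt_mulStar U₀ φ hφ0 ξ hφξ
  refine ⟨γ, ξ, hγ0', hγdiff, hγfib, hξd, hγT, ?_⟩
  rw [← hD.deriv]
  exact hEL φ hφ0 hφfib hφdiff

end Summit.QuantumFields.YangMills.Theorems.Prop7FirstVariationFibreCurveStat

end
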